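import Summits.HodgeConjecture.HodgeConjecture.Theorems.R90S6TreeFixDataFlickerU3HypCorner     -- ★ FILE 0c (this seat): (H.1c) `flickerFix_natCard_fixedBy_hyp_tpi_corner`, (H.2c) `…_hyp_tOne_corner` (corner frame, no hce)
import Summits.HodgeConjecture.HodgeConjecture.Theorems.R90S6FlickerLiteralShiftAdjoin           -- ★ R2M B (p05): `exists_v_eq_v_pow_of_ne_zero` (an integral non-zero element has an exponent)
import Literature.NumberTheory.Rogawski1990.UnitOrbitalIntegralInertValueThetaZeroTrichotomy        -- ★ `UnitaryGroup.add_sub_two_mul_ne_zero_of_normOne` (`a + c ≠ 2b`)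
import Literature.NumberTheory.Rogawski1990.UnitOrbitalIntegralInertSumsThetaOne                    -- ★ `Flicker1998.phiOne_zero` (`φ₁(·, 0) = 0`)
import HarnessLib

/-!
# R90 · S6 «Ch. 14.1–14.5 stable trace formula» — card GF1 FILE 2b, CONGRUENT BLOCK: THE HYPERSPECIAL COLUMN `V₀(tᵢ)` OF FLICKER'S FOUR LITERALS IN REGIME R-II
# (`|a − b| = |ϖⁿ|`, `n ≥ 1`, `|a − c| = 1`): `V₀(t₁) = φ₀(q; n, 0, 0)`, `V₀(t₂) = 0`, `V₀(t₃) = φ₁(q; 0, n)`, `V₀(t₄) = 0` (`Theorems/R90S6TreeFixDataFlickerU3Congruent.lean`)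

Cell `hodgecm-mathlib`, crux H413 (`stmt-HodgeConjecture-24833`), route of record `HCCMUnconditional`; programme R90-TF (brief `director/R90-BRIEF.v2.md`
1f40d54518340a35), section S6 (base `R90-C14`, dealer R90-C14-plan (g2→g3)), seat R90-C14-p10 (g2); card GF1 FILE 2b (cut K2Liu-p14 (g5) 02:49:55Z; dealer (g3) RULINGS #1
(R13) «pre-draft 2b-Congruent», #8 «GO»).  Lane `--kind proof --supports stmt-HodgeConjecture-24833 --as helper`; THEOREMS ONLY (no definition, no instance, no notation, no named
fact, no kit, no `sorry`); imports = ★ FILE 0c `R90S6TreeFixDataFlickerU3HypCorner` + ★ R2M B `R90S6FlickerLiteralShiftAdjoin` + ★ Literature `…ThetaZeroTrichotomy`,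
`…SumsThetaOne` + HarnessLib (never `Lines/`).

THE PARTNER FILE.  ★ R2M C `R90S6TorusFixedSpecialCountTwoCongruentFlicker` (R90-C14-p05) gives the SPECIAL column in regime R-II, pairing `a ≡ b`: (3a) `V₁(t₁) = 1 + q·φ₀(n−1,0,0)`,
(3b) `V₁(t₂) = 1`, (3c) `V₁(t₃) = 1 + q·φ₁(0, n−1)`, (3d) `V₁(t₄) = 1`.  THIS FILE = the HYPERSPECIAL column in the SAME regime letters `{n} (hn : 1 ≤ n)
(hab : |a − b| = |ϖⁿ|) (hac : |a − c| = 1)` and the SAME corner frame (`hd : LocalConjDatum`, complete DVR integers with finite residue field `#𝓀 = q²`, `hσO`, `y σy = −2`, `a₀`),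
read off ★ FILE 0c's all-regime closed forms by computing the depth pattern of the regime (`|c − b| = |b − c| = 1` by ultrametricity; the exponent of `a + c − 2b` exists and is
irrelevant): the (G1) deep-R-II discharge (R90-C14-p02, `(U0) ∧ (U1)` road) and K2Liu-p14's FLSUM substitute the eight values `(V₀, V₁)(t₁…t₄)` BY NAME.  The other two R-II pairings
(`a ≡ c`, `b ≡ c`) are these theorems after relabelling `(a, b, c)`, as in ★ R2M C and ★ Regimes.
* (C.1) **`flickerFix_natCard_fixedBy_hyp_tOne_congruentAB`** — `V₀(t₁) = phiZero q n 0 0` in `ℚ` (`t₁ = t_1(a,b,c)`; centre hyperspecial; Flicker Prop. 14);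
* (C.2) **`flickerFix_natCard_fixedBy_hyp_tpi_abc_congruentAB`** — `V₀(t₂) = 0` in `ℕ` (`t₂ = t_ϖ(a,b,c)`: the separated eigenvalue `c` on an ODD line; `φ₁(n, 0) = 0`, ★ `phiOne_zero`);
* (C.3) **`flickerFix_natCard_fixedBy_hyp_tpi_acb_congruentAB`** — `V₀(t₃) = phiOne q 0 n` in `ℚ` (`t₃ = t_ϖ(a,c,b)`: the congruent pair `a ≡ b` split across the `ϖ`-plane; Prop. 11);
* (C.4) **`flickerFix_natCard_fixedBy_hyp_tpi_bac_congruentAB`** — `V₀(t₄) = 0` in `ℕ` (`t₄ = t_ϖ(b,a,c)`; `φ₁(n, 0) = 0`).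
R-III boundary (`n = 0`) is ★ `R90S6FlickerLiteralCounts` ∕ ★ 2b-Separated; R-I (all depths ≥ 1) is the sequel `R90S6TreeFixDataFlickerU3Unipotent` beside p05's R-I twin.
HONEST LABEL: regime specialisation of ★ closed forms (the unit-FL hyperspecial counts), count-neutral until (E1) ∕ (U1) consume it; proves no printed global statement, discharges no
citation; HC_CM is proved only modulo the 7 printed citations (2 remaining named inputs: hLiu418 = stmt-HodgeConjecture-24832, h413 = stmt-HodgeConjecture-24833) until rung 0
closes.  REL ≠ ★ ≠ BUILT.

## References
* [Flicker1998UnitaryFL] Y. Z. Flicker, *Elementary proof of the fundamental lemma for a unitary group*, Canad. J. Math. 50 (1998): §2 Prop. 3 pp. 78–79 (the literals), Prop. 11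
  p. 87 (`θ̄ = 1`), Prop. 14 p. 94 (`θ̄ = 0`), §6 p. 95 (`Φ(t₃) = φ(N, N₂, N₁)`, `Φ(t₄) = φ(N₁, N, N₂)`).
* [Rogawski1990] J. D. Rogawski, *Automorphic Representations of Unitary Groups in Three Variables*, Ann. of Math. Stud. 123 (1990): §4.9 Prop. 4.9.1 (b) pp. 54–55.
* [Kottwitz1986BaseChangeUnits] R. E. Kottwitz, *Base change for unit elements of Hecke algebras*, Compositio Math. 60 (1986): §3.
-/

set_option autoImplicit false
-- the mandated namespace repeats the single-problem summit's segment (`HodgeConjecture.HodgeConjecture`)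
set_option linter.dupNamespace false

noncomputable section

open MulAction IsLocalRing
open scoped Valued WithZero Matrix MatrixGroups
open Literature.NumberTheory.Automorphic Literature.NumberTheory.Automorphic.HermitianLattice Literature.NumberTheory.Automorphic.UnitaryLatticeTree
  Literature.NumberTheory.Automorphic.UnitaryGroup
open Literature.NumberTheory.Rogawski1990.Flicker1998 (phiZero phiOne phiOne_zero)

namespace Summit.HodgeConjecture.HodgeConjecture.R90.S6

section CongruentAB

variable {K : Type*} [Field K] [Valued K ℤᵐ⁰] [ValuativeRel K] [(Valued.v : Valuation K ℤᵐ⁰).Compatible]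
  [IsDiscreteValuationRing (Valued.integer K)] [IsAdicComplete (maximalIdeal (Valued.integer K)) (Valued.integer K)]
  {σ : K →+* K} {ϖ : K}

omit [ValuativeRel K] [(Valued.v : Valuation K ℤᵐ⁰).Compatible] [IsDiscreteValuationRing (Valued.integer K)]
  [IsAdicComplete (maximalIdeal (Valued.integer K)) (Valued.integer K)] in
/-- The depth pattern of regime R-II, pairing `a ≡ b`: `|a − b| = |ϖⁿ| < 1 = |a − c|` forces `|x − y| = 1 = |ϖ⁰|` for the two differences across the separated eigenvalue
(`c − b = (a − b) − (a − c)`, ultrametric), and `|a − c| = |ϖ⁰|`. [cite: Flicker1998UnitaryFL, §6 p. 95] -/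
private theorem flickerFix_depths_congruentAB (hd : LocalConjDatum σ ϖ) {a b cc : K} {n : ℕ} (hn : 1 ≤ n)
    (hab : Valued.v (a - b) = Valued.v (ϖ ^ n)) (hac : Valued.v (a - cc) = 1) :
    Valued.v (a - cc) = Valued.v (ϖ ^ 0) ∧ Valued.v (cc - b) = Valued.v (ϖ ^ 0) ∧ Valued.v (b - cc) = Valued.v (ϖ ^ 0) := by
  have hlt : Valued.v (a - b) < Valued.v (a - cc) := by
    rw [hab, hac, map_pow, hd.vϖ, ← WithZero.exp_nsmul, ← WithZero.exp_zero]
    exact WithZero.exp_lt_exp.2 (by simp; omega)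
  have hcb : Valued.v (cc - b) = 1 := by
    rw [show cc - b = (a - b) - (a - cc) by ring, Valued.v.map_sub_eq_of_lt_right hlt, hac]
  refine ⟨by rw [pow_zero, map_one, hac], by rw [pow_zero, map_one, hcb], by rw [pow_zero, map_one, Valuation.map_sub_swap, hcb]⟩

set_option synthInstance.maxHeartbeats 200000 in
-- as in the ★ corner heads: the `H`-action on `H ⧸ (K^{u_m} ∩ H)` is found through the large subgroup terms of the `U(2,1)` frame
/-- **(C.1) `V₀(t₁) = φ₀(q; n, 0, 0)` IN REGIME R-II (`a ≡ b`)** — the hyperspecial fixed-coset count of `t₁ = t_1(a,b,c)` with `|a − b| = |ϖⁿ|` (`n ≥ 1`), `|a − c| = 1`: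
`#Fix_{t₁}(U ⧸ (GL₃(𝒪) ⊓ U)) = phiZero q n 0 0` in `ℚ` (★ FILE 0c (H.2c) at the depth pattern `(N₁, N₂, N) = (n, 0, 0)`; the exponent of `a + c − 2b` exists by ★
`add_sub_two_mul_ne_zero_of_normOne` + ★ `exists_v_eq_v_pow_of_ne_zero` and does not enter the value).  Partner: ★ R2M C (3a) `V₁(t₁) = 1 + q·φ₀(n−1, 0, 0)`.
[cite: Flicker1998UnitaryFL, Prop. 14 p. 94; §6 p. 95] [cite: Rogawski1990, §4.9 Prop. 4.9.1 (b) p. 55] -/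
theorem flickerFix_natCard_fixedBy_hyp_tOne_congruentAB (hd : LocalConjDatum σ ϖ)
    (hσO : ∀ y : Valued.integer K, (σ.comp (Valued.integer K).subtype) y ∈ Valued.integer K) {y : K} (hy : y * σ y = -2)
    [Fintype (ResidueField (Valued.integer K))] {q : ℕ} (hq : Fintype.card (ResidueField (Valued.integer K)) = q ^ 2)
    {a₀ : Valued.integer K} (ha₀ : IsUnit (((σ.comp (Valued.integer K).subtype).codRestrict (Valued.integer K) hσO) a₀ - a₀))
    {e a b cc : K} (h2e : 2 * e = 1) (ha : σ a * a = 1) (hb : σ b * b = 1) (hcc : σ cc * cc = 1)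
    (γ : ↥(unitaryGroupOfForm σ ((StdForm.antidiagonal 3).over K)))
    (hγ : ((γ : GL (Fin 3) K) : Matrix (Fin 3) (Fin 3) K) = !![e * (a + cc), 0, -(e * (a - cc)); 0, b, 0; -(e * (a - cc)), 0, e * (a + cc)])
    {n : ℕ} (hn : 1 ≤ n) (hab : Valued.v (a - b) = Valued.v (ϖ ^ n)) (hac : Valued.v (a - cc) = 1)
    [Fintype (fixedBy (↥(unitaryGroupOfForm σ ((StdForm.antidiagonal 3).over K)) ⧸
      (glInt 3 K).subgroupOf (unitaryGroupOfForm σ ((StdForm.antidiagonal 3).over K))) γ)] :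
    (Nat.card (fixedBy (↥(unitaryGroupOfForm σ ((StdForm.antidiagonal 3).over K)) ⧸
        (glInt 3 K).subgroupOf (unitaryGroupOfForm σ ((StdForm.antidiagonal 3).over K))) γ) : ℚ) = phiZero q n 0 0 := by
  haveI : Finite (ResidueField (Valued.integer K)) := Finite.of_fintype _
  have hq' : Nat.card (ResidueField (Valued.integer K)) = q ^ 2 := by rw [Nat.card_eq_fintype_card, hq]
  obtain ⟨hN, hN₂, -⟩ := flickerFix_depths_congruentAB hd hn hab hac
  have hac0 : a ≠ cc := fun h => by rw [h, sub_self, map_zero] at hac; exact zero_ne_one hac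
  have hva : Valued.v a = 1 := (flickerLiteral_norm_one_letters σ hd.vσ ha).2
  have hvb : Valued.v b = 1 := (flickerLiteral_norm_one_letters σ hd.vσ hb).2
  have hvc : Valued.v cc = 1 := (flickerLiteral_norm_one_letters σ hd.vσ hcc).2
  have hs1 : Valued.v (a + cc - 2 * b) ≤ 1 := by
    refine le_trans (Valuation.map_sub _ _ _) (max_le (le_trans (Valuation.map_add _ _ _) (max_le hva.le hvc.le)) ?_)
    rw [map_mul, hd.v2, one_mul]; exact hvb.le
  obtain ⟨Np, hNp⟩ := exists_v_eq_v_pow_of_ne_zero hd (add_sub_two_mul_ne_zero_of_normOne σ hd ha hb hcc hac0) hs1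
  exact flickerFix_natCard_fixedBy_hyp_tOne_corner hd hσO hy hq' ha₀ h2e ha hb hcc γ hγ hN hNp hab hN₂

set_option synthInstance.maxHeartbeats 200000 in
-- as in the ★ corner heads: the `H`-action on `H ⧸ (K^{u_m} ∩ H)` is found through the large subgroup terms of the `U(2,1)` frame
/-- **(C.2) `V₀(t₂) = 0` IN REGIME R-II (`a ≡ b`)** — `t₂ = t_ϖ(a,b,c)` with `|a − b| = |ϖⁿ|` (`n ≥ 1`), `|a − c| = 1` fixes NO hyperspecial vertex: ★ FILE 0c (H.1c) gives
`φ₁(q; n, 0)` (`N = ord(a − c) = 0`), and `φ₁(·, 0) = 0` (★ `phiOne_zero`; the separated eigenvalue `c` sits on an odd eigenline).  Partner: ★ R2M C (3b) `V₁(t₂) = 1`.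
[cite: Flicker1998UnitaryFL, Prop. 11 p. 87; §6 p. 95] [cite: Rogawski1990, §4.9 Prop. 4.9.1 (b) p. 55] -/
theorem flickerFix_natCard_fixedBy_hyp_tpi_abc_congruentAB (hd : LocalConjDatum σ ϖ)
    (hσO : ∀ y : Valued.integer K, (σ.comp (Valued.integer K).subtype) y ∈ Valued.integer K) {y : K} (hy : y * σ y = -2)
    [Fintype (ResidueField (Valued.integer K))] {q : ℕ} (hq : Fintype.card (ResidueField (Valued.integer K)) = q ^ 2)
    {a₀ : Valued.integer K} (ha₀ : IsUnit (((σ.comp (Valued.integer K).subtype).codRestrict (Valued.integer K) hσO) a₀ - a₀))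
    {e a b cc : K} (h2e : 2 * e = 1) (ha : σ a * a = 1) (hb : σ b * b = 1) (hcc : σ cc * cc = 1)
    (γ : ↥(unitaryGroupOfForm σ ((StdForm.antidiagonal 3).over K)))
    (hγ : ((γ : GL (Fin 3) K) : Matrix (Fin 3) (Fin 3) K) = !![e * (a + cc), 0, -(e * (a - cc) * ϖ); 0, b, 0; -(e * (a - cc) * ϖ⁻¹), 0, e * (a + cc)])
    {n : ℕ} (hn : 1 ≤ n) (hab : Valued.v (a - b) = Valued.v (ϖ ^ n)) (hac : Valued.v (a - cc) = 1)
    [Fintype (fixedBy (↥(unitaryGroupOfForm σ ((StdForm.antidiagonal 3).over K)) ⧸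
      (glInt 3 K).subgroupOf (unitaryGroupOfForm σ ((StdForm.antidiagonal 3).over K))) γ)] :
    Nat.card (fixedBy (↥(unitaryGroupOfForm σ ((StdForm.antidiagonal 3).over K)) ⧸
        (glInt 3 K).subgroupOf (unitaryGroupOfForm σ ((StdForm.antidiagonal 3).over K))) γ) = 0 := by
  haveI : Finite (ResidueField (Valued.integer K)) := Finite.of_fintype _
  have hq' : Nat.card (ResidueField (Valued.integer K)) = q ^ 2 := by rw [Nat.card_eq_fintype_card, hq]
  obtain ⟨hN, hN₂, -⟩ := flickerFix_depths_congruentAB hd hn hab hac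
  have h := flickerFix_natCard_fixedBy_hyp_tpi_corner hd hσO hy hq' ha₀ h2e ha hb hcc γ hγ hN hab hN₂
  rw [phiOne_zero] at h
  exact_mod_cast h

set_option synthInstance.maxHeartbeats 200000 in
-- as in the ★ corner heads: the `H`-action on `H ⧸ (K^{u_m} ∩ H)` is found through the large subgroup terms of the `U(2,1)` frame
/-- **(C.3) `V₀(t₃) = φ₁(q; 0, n)` IN REGIME R-II (`a ≡ b`)** — `t₃ = t_ϖ(a,c,b) = !![e(a+b), 0, −e(a−b)ϖ; 0, c, 0; −e(a−b)ϖ⁻¹, 0, e(a+b)]` ((E1) sheet's `hγ₃` bytes): the congruent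
pair `a ≡ b` now spans the `ϖ`-plane, so ★ FILE 0c (H.1c) reads with letters `(a, c, b)`: `(N₁, N) = (ord(a − c), ord(a − b)) = (0, n)` and `#Fix_{t₃}(U ⧸ (GL₃(𝒪) ⊓ U)) = phiOne q 0 n`
in `ℚ` (centre special; Flicker `Φ(t₃) = φ(N, N₂, N₁)`).  Partner: ★ R2M C (3c) `V₁(t₃) = 1 + q·φ₁(0, n−1)`. [cite: Flicker1998UnitaryFL, Prop. 11 p. 87; §6 p. 95]
[cite: Rogawski1990, §4.9 Prop. 4.9.1 (b) p. 55] -/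
theorem flickerFix_natCard_fixedBy_hyp_tpi_acb_congruentAB (hd : LocalConjDatum σ ϖ)
    (hσO : ∀ y : Valued.integer K, (σ.comp (Valued.integer K).subtype) y ∈ Valued.integer K) {y : K} (hy : y * σ y = -2)
    [Fintype (ResidueField (Valued.integer K))] {q : ℕ} (hq : Fintype.card (ResidueField (Valued.integer K)) = q ^ 2)
    {a₀ : Valued.integer K} (ha₀ : IsUnit (((σ.comp (Valued.integer K).subtype).codRestrict (Valued.integer K) hσO) a₀ - a₀))
    {e a b cc : K} (h2e : 2 * e = 1) (ha : σ a * a = 1) (hb : σ b * b = 1) (hcc : σ cc * cc = 1)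
    (γ : ↥(unitaryGroupOfForm σ ((StdForm.antidiagonal 3).over K)))
    (hγ : ((γ : GL (Fin 3) K) : Matrix (Fin 3) (Fin 3) K) = !![e * (a + b), 0, -(e * (a - b) * ϖ); 0, cc, 0; -(e * (a - b) * ϖ⁻¹), 0, e * (a + b)])
    {n : ℕ} (hn : 1 ≤ n) (hab : Valued.v (a - b) = Valued.v (ϖ ^ n)) (hac : Valued.v (a - cc) = 1)
    [Fintype (fixedBy (↥(unitaryGroupOfForm σ ((StdForm.antidiagonal 3).over K)) ⧸
      (glInt 3 K).subgroupOf (unitaryGroupOfForm σ ((StdForm.antidiagonal 3).over K))) γ)] :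
    (Nat.card (fixedBy (↥(unitaryGroupOfForm σ ((StdForm.antidiagonal 3).over K)) ⧸
        (glInt 3 K).subgroupOf (unitaryGroupOfForm σ ((StdForm.antidiagonal 3).over K))) γ) : ℚ) = phiOne q 0 n := by
  haveI : Finite (ResidueField (Valued.integer K)) := Finite.of_fintype _
  have hq' : Nat.card (ResidueField (Valued.integer K)) = q ^ 2 := by rw [Nat.card_eq_fintype_card, hq]
  obtain ⟨hN, -, hbc⟩ := flickerFix_depths_congruentAB hd hn hab hac
  -- letters `(a, c, b)`: `N = ord(a − b) = n`, `N₁ = ord(a − c) = 0`, `N₂ = ord(b − c) = 0`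
  exact flickerFix_natCard_fixedBy_hyp_tpi_corner hd hσO hy hq' ha₀ h2e ha hcc hb γ hγ hab hN hbc

set_option synthInstance.maxHeartbeats 200000 in
-- as in the ★ corner heads: the `H`-action on `H ⧸ (K^{u_m} ∩ H)` is found through the large subgroup terms of the `U(2,1)` frame
/-- **(C.4) `V₀(t₄) = 0` IN REGIME R-II (`a ≡ b`)** — `t₄ = t_ϖ(b,a,c) = !![e(b+c), 0, −e(b−c)ϖ; 0, a, 0; −e(b−c)ϖ⁻¹, 0, e(b+c)]` ((E1) sheet's `hγ₄` bytes) fixes NO hyperspecial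
vertex: ★ FILE 0c (H.1c) with letters `(b, a, c)` gives `φ₁(q; n, 0)` (`N = ord(b − c) = 0`), `= 0` by ★ `phiOne_zero`.  Partner: ★ R2M C (3d) `V₁(t₄) = 1`.
[cite: Flicker1998UnitaryFL, Prop. 11 p. 87; §6 p. 95] [cite: Rogawski1990, §4.9 Prop. 4.9.1 (b) p. 55] -/
theorem flickerFix_natCard_fixedBy_hyp_tpi_bac_congruentAB (hd : LocalConjDatum σ ϖ)
    (hσO : ∀ y : Valued.integer K, (σ.comp (Valued.integer K).subtype) y ∈ Valued.integer K) {y : K} (hy : y * σ y = -2)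
    [Fintype (ResidueField (Valued.integer K))] {q : ℕ} (hq : Fintype.card (ResidueField (Valued.integer K)) = q ^ 2)
    {a₀ : Valued.integer K} (ha₀ : IsUnit (((σ.comp (Valued.integer K).subtype).codRestrict (Valued.integer K) hσO) a₀ - a₀))
    {e a b cc : K} (h2e : 2 * e = 1) (ha : σ a * a = 1) (hb : σ b * b = 1) (hcc : σ cc * cc = 1)
    (γ : ↥(unitaryGroupOfForm σ ((StdForm.antidiagonal 3).over K)))
    (hγ : ((γ : GL (Fin 3) K) : Matrix (Fin 3) (Fin 3) K) = !![e * (b + cc), 0, -(e * (b - cc) * ϖ); 0, a, 0; -(e * (b - cc) * ϖ⁻¹), 0, e * (b + cc)])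
    {n : ℕ} (hn : 1 ≤ n) (hab : Valued.v (a - b) = Valued.v (ϖ ^ n)) (hac : Valued.v (a - cc) = 1)
    [Fintype (fixedBy (↥(unitaryGroupOfForm σ ((StdForm.antidiagonal 3).over K)) ⧸
      (glInt 3 K).subgroupOf (unitaryGroupOfForm σ ((StdForm.antidiagonal 3).over K))) γ)] :
    Nat.card (fixedBy (↥(unitaryGroupOfForm σ ((StdForm.antidiagonal 3).over K)) ⧸
        (glInt 3 K).subgroupOf (unitaryGroupOfForm σ ((StdForm.antidiagonal 3).over K))) γ) = 0 := by
  haveI : Finite (ResidueField (Valued.integer K)) := Finite.of_fintype _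
  have hq' : Nat.card (ResidueField (Valued.integer K)) = q ^ 2 := by rw [Nat.card_eq_fintype_card, hq]
  obtain ⟨hN, hN₂, hbc⟩ := flickerFix_depths_congruentAB hd hn hab hac
  -- letters `(b, a, c)`: `N = ord(b − c) = 0`, `N₁ = ord(b − a) = n`, `N₂ = ord(c − a) = 0`
  have hba : Valued.v (b - a) = Valued.v (ϖ ^ n) := by rw [Valuation.map_sub_swap, hab]
  have hca : Valued.v (cc - a) = Valued.v (ϖ ^ 0) := by rw [Valuation.map_sub_swap, hN]
  have h := flickerFix_natCard_fixedBy_hyp_tpi_corner hd hσO hy hq' ha₀ h2e hb ha hcc γ hγ hbc hba hca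
  rw [phiOne_zero] at h
  exact_mod_cast h

end CongruentAB

end Summit.HodgeConjecture.HodgeConjecture.R90.S6

end
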